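import Summits.Ventures.DiscreteObjects.PP12.BaerFixedPoints
import Summits.Ventures.DiscreteObjects.PP12.FixedPointsEqFixedLines

/-!
# A collineation with exactly `n + 1` fixed points has a fixed line with at most one fixed point (Baer; kernel, general order)
Framing: lottery ticket; floor = certified bounds/negative ranges.

REPLICATION of a classical fact (Baer 1946/47; Dembowski 1968, 4.1.7–4.1.8: `f(φ) = n + 1` iff `φ` is an elation), in the
following form, for a collineation `σ` of a finite projective plane of order `n`:

* `card_on_fixed_lines_le` — if every fixed line carries at least `k` fixed points, the non-fixed points lying on fixed lines
  number at most `F(σ)·(n + 1 − k)` (`F` = number of fixed lines);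
* **`false_of_card_fixed_eq_succ_order`** — `σ` cannot have exactly `n + 1` fixed points while every fixed line carries at least
  two of them. (By Baer's equality there are `n + 1` fixed lines, so at most `(n+1)(n−1) < n²` of the `n²` non-fixed points lie on
  fixed lines; a non-fixed point on no fixed line contradicts Baer's lemma `mem_fixedLine_of_order_le_card_fixed`.)

In particular a Bruck-extremal subplane (order `m` in a plane of order `m² + m`, `m ≥ 1`: `m² + m + 1 = n + 1` fixed points, `m + 1 ≥ 2`
on each fixed line) is never the fixed structure of a collineation — Roth 1964's theorem in the boundary case, of which
`NoPlanarOrderThree.no_planar_order_three` (`(m, n) = (3, 12)`) is the census instance (`no_planar_order_three''` below re-derives it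
in two lines). Cell pub-namedobj (target M), designs g10; no `sorry`, no new axioms.
-/

namespace Summit.Ventures.DiscreteObjects.PP12

open Configuration Finset
open scoped Classical

namespace Collineation

variable {P L : Type*} [Membership P L] [ProjectivePlane P L] [Fintype P] [Fintype L]
  [DecidableEq P] [DecidableEq L] (σ : Collineation P L)

/-- If every fixed line carries at least `k` fixed points, then at most `F(σ) · (n + 1 − k)` non-fixed points lie on fixed lines. -/
theorem card_on_fixed_lines_le {k : ℕ} (hk : ∀ l : L, σ.onLines l = l → k ≤ σ.fixedOnLine l) :
    (univ.filter fun y : P => σ.onPoints y ≠ y ∧ ∃ l : L, σ.onLines l = l ∧ y ∈ l).card ≤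
      fixedCard σ.onLines * (ProjectivePlane.order P L + 1 - k) := by
  set T : Finset L := univ.filter fun l : L => σ.onLines l = l with hT
  have hTcard : T.card = fixedCard σ.onLines := rfl
  -- the set is contained in the union over fixed lines of their non-fixed points
  have hsub : (univ.filter fun y : P => σ.onPoints y ≠ y ∧ ∃ l : L, σ.onLines l = l ∧ y ∈ l) ⊆
      T.biUnion fun l => univ.filter fun y : P => y ∈ l ∧ σ.onPoints y ≠ y := by
    intro y hy
    simp only [mem_filter, mem_univ, true_and] at hy
    obtain ⟨hyf, l, hl, hyl⟩ := hy
    exact Finset.mem_biUnion.mpr ⟨l, by simp [hT, hl], by simp [hyl, hyf]⟩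
  refine (Finset.card_le_card hsub).trans ((Finset.card_biUnion_le).trans ?_)
  -- each fixed line carries exactly (n+1) - fixedOnLine non-fixed points
  have hline : ∀ l ∈ T, (univ.filter fun y : P => y ∈ l ∧ σ.onPoints y ≠ y).card ≤ ProjectivePlane.order P L + 1 - k := by
    intro l hl
    have fl : σ.onLines l = l := by simpa [hT] using hl
    have hall : (univ.filter fun y : P => y ∈ l).card = ProjectivePlane.order P L + 1 := by
      rw [← Fintype.card_subtype, ← Nat.card_eq_fintype_card]
      exact ProjectivePlane.pointCount_eq P l
    have hsplit := Finset.card_filter_add_card_filter_not (s := univ.filter fun y : P => y ∈ l) (fun y : P => σ.onPoints y = y)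
    have e1 : ((univ.filter fun y : P => y ∈ l).filter fun y => σ.onPoints y = y).card = σ.fixedOnLine l := by
      unfold fixedOnLine; congr 1; ext y; simp
    have e2 : ((univ.filter fun y : P => y ∈ l).filter fun y => ¬ σ.onPoints y = y)
        = univ.filter fun y : P => y ∈ l ∧ σ.onPoints y ≠ y := by
      ext y; simp
    rw [e1, e2, hall] at hsplit
    have := hk l fl
    omega
  calc ∑ l ∈ T, (univ.filter fun y : P => y ∈ l ∧ σ.onPoints y ≠ y).card
      ≤ ∑ l ∈ T, (ProjectivePlane.order P L + 1 - k) := Finset.sum_le_sum hline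
    _ = fixedCard σ.onLines * (ProjectivePlane.order P L + 1 - k) := by rw [Finset.sum_const, smul_eq_mul, hTcard]

/-- **No collineation has exactly `n + 1` fixed points with at least two on every fixed line** (Baer: `f = n + 1` forces an
elation, whose fixed lines through the centre other than the axis carry a single fixed point). -/
theorem false_of_card_fixed_eq_succ_order (hf : fixedCard σ.onPoints = ProjectivePlane.order P L + 1)
    (hk : ∀ l : L, σ.onLines l = l → 2 ≤ σ.fixedOnLine l) : False := by
  -- write the order as k + 2
  obtain ⟨k, hk2⟩ : ∃ k, ProjectivePlane.order P L = k + 2 :=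
    ⟨ProjectivePlane.order P L - 2, by have := ProjectivePlane.one_lt_order P L; omega⟩
  -- number of fixed lines = n + 1 (Baer's equality)
  have hF : fixedCard σ.onLines = k + 3 := by rw [← σ.fixedCard_points_eq_lines, hf, hk2]
  -- at most (n+1)(n-1) non-fixed points lie on fixed lines
  have hU : (univ.filter fun y : P => σ.onPoints y ≠ y ∧ ∃ l : L, σ.onLines l = l ∧ y ∈ l).card ≤ (k + 3) * (k + 1) := by
    have h := σ.card_on_fixed_lines_le hk
    rw [hF, hk2] at h
    have e : k + 2 + 1 - 2 = k + 1 := by omega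
    rw [e] at h
    exact h
  -- there are n² non-fixed points
  have hN : (k + 3) + (univ.filter fun y : P => σ.onPoints y ≠ y).card = (k + 2) ^ 2 + (k + 2) + 1 := by
    have hsplit := Finset.card_filter_add_card_filter_not (s := (univ : Finset P)) (fun y : P => σ.onPoints y = y)
    rw [Finset.card_univ, ProjectivePlane.card_points P L, hk2] at hsplit
    change fixedCard σ.onPoints + _ = _ at hsplit
    rw [hf, hk2] at hsplit
    have e : (univ.filter fun y : P => ¬ σ.onPoints y = y) = univ.filter fun y : P => σ.onPoints y ≠ y := by ext; simp
    rw [e] at hsplit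
    omega
  have h1 : (k + 3) * (k + 1) + 1 = (k + 2) ^ 2 := by ring
  -- hence some non-fixed point lies on no fixed line
  have hlt : (univ.filter fun y : P => σ.onPoints y ≠ y ∧ ∃ l : L, σ.onLines l = l ∧ y ∈ l).card <
      (univ.filter fun y : P => σ.onPoints y ≠ y).card := by omega
  have hss : (univ.filter fun y : P => σ.onPoints y ≠ y ∧ ∃ l : L, σ.onLines l = l ∧ y ∈ l) ⊆
      (univ.filter fun y : P => σ.onPoints y ≠ y) := by
    intro y hy; simp only [mem_filter, mem_univ, true_and] at hy ⊢; exact hy.1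
  obtain ⟨Q, hQ1, hQ2⟩ := Finset.exists_of_ssubset
    (Finset.ssubset_iff_subset_ne.mpr ⟨hss, fun e => by rw [e] at hlt; exact lt_irrefl _ hlt⟩)
  simp only [mem_filter, mem_univ, true_and, not_and, not_exists] at hQ1 hQ2
  obtain ⟨l, hl, hQl⟩ := σ.mem_fixedLine_of_order_le_card_fixed (by rw [hf]; omega) hQ1
  exact hQ2 hQ1 l hl hQl

/-- The census instance once more: no planar collineation of order 3 on a plane of order 12 (`13 = 12 + 1` fixed points, `4 ≥ 2`
on every fixed line) — here from the general Baer criterion, without `PlanarExterior`'s counts. -/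
theorem no_planar_order_three'' (h12 : ProjectivePlane.order P L = 12) (hf13 : fixedCard σ.onPoints = 13)
    (hk4 : ∀ l : L, σ.onLines l = l → σ.fixedOnLine l = 4) : False :=
  σ.false_of_card_fixed_eq_succ_order (by rw [h12, hf13]) (fun l hl => by rw [hk4 l hl]; norm_num)

end Collineation

end Summit.Ventures.DiscreteObjects.PP12
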